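import Summits.BirchSwinnertonDyer.BirchSwinnertonDyer.Theorems.ManinLocalTwoThreeVeluTwoIsogenous
import Summits.BirchSwinnertonDyer.BirchSwinnertonDyer.Theorems.ManinLocalTwoThreeAdditiveIsogenyInvariant
import HarnessLib

/-!
# The tame Néron-scalar TABLE at `2` for rational `2`-torsion points (E-an-120 assembled): `IV ⟹ u = 1`, `IV* ⟹ u = 2`

Summit `BirchSwinnertonDyer`, route `ManinLocalTwoThree` (cell bsd-f2-manin), deciding crux C2 `ManinOddAtFour` (stmt-BirchSwinnertonDyer-22967).
One citable statement: `W/ℚ` globally minimal, `4 ∥ N` (so Kodaira `IV` with `ord₂ Δ_min = 4` or `IV*` with `8`), `q` a rational `2`-torsion abscissa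
(`Ψ₂²_W(q − b₂/12) = 0`), `(A, B) = (720q² − 4c₄, 19008q³ − 144c₄q)` the `u = 1` Vélu `2`-pair:

* `IV` (`ord₂ Δ_min = 4`): an ISOGENOUS globally minimal curve carries `(A, B)` and has `ord₂ Δ_min = 8`; NO globally minimal curve carries
  `(2⁻⁴A, 2⁻⁶B)` — `u = 1`, unconditionally (p647511/p648015);
* `IV*` (`ord₂ Δ_min = 8`): every globally minimal carrier of `(A, B)` has `ord₂ Δ_min = 16` and every carrier of `(2⁻⁴A, 2⁻⁶B)` has `ord₂ Δ_min = 4`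
  (unconditional); hence if no curve isogenous to `W` is wild at `2` (`8 ∤ N(W′)`; automatic from `exists_isNewformOf` + a newform of `W`, and `4 ∣ N(W′)`
  holds unconditionally by `sq_dvd_conductorNorm_of_isIsogenous`), an isogenous globally minimal curve carries `(2⁻⁴A, 2⁻⁶B)` — `u = 2`.

* `tameTwo_neronScalar_table` (the unconditional rows + the `IV*` existence under «no wild isogenous curve»),
* `tameTwo_neronScalar_table_of_isNewformOf` (all rows, granted `exists_isNewformOf` and a newform of `W`).

HONEST FRAMING: local structure; C2, Manin's conjecture and BSD are not proved.  No definitions, no named facts, no sorry.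
References: [SilvermanATAEC1994] IV.9.4 Table 4.1; [DokchitserDokchitser2015LocalInvariants] Table 1; [AtkinLehner1970] Thm. 4; HOME/MEMO-an.md §67 (E-an-120).
-/

set_option linter.dupNamespace false
set_option autoImplicit false

noncomputable section

open scoped Classical

open WeierstrassCurve Polynomial CongruenceSubgroup
  Literature.NumberTheory.EllipticCurves Literature.NumberTheory.EllipticCurves.ModularForms
  Summit.BirchSwinnertonDyer.Rank1Residual.Additive

namespace Summit.BirchSwinnertonDyer.BirchSwinnertonDyer.Theorems.ManinLocalTwoThree

/-- **The tame Néron-scalar table at `2` (E-an-120), modularity-free form.**  `W` globally minimal, `4 ∥ N`, `q` a rational `2`-torsion abscissa: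
(`ord₂ Δ_min = 4` ⟹ isogenous `u = 1` carrier with `ord₂ Δ_min = 8` ∧ no `u = 2` carrier) ∧
(`ord₂ Δ_min = 8` ⟹ (every `u = 1` carrier has `ord₂ Δ_min = 16`) ∧ (every `u = 2` carrier has `ord₂ Δ_min = 4`) ∧
 («no isogenous curve is wild at `2`» ⟹ isogenous `u = 2` carrier with `ord₂ Δ_min = 4`)).
[cite: SilvermanATAEC1994, IV.9.4 Table 4.1] [cite: DokchitserDokchitser2015LocalInvariants, Table 1] -/
theorem tameTwo_neronScalar_table (W : WeierstrassCurve ℚ) [W.IsElliptic] [W.IsGloballyMinimal]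
    (h4 : 2 ^ 2 ∣ W.conductorNorm ℤ) (h8 : ¬ 2 ^ 3 ∣ W.conductorNorm ℤ) (q : ℚ) (hq : W.Ψ₂Sq.eval (q - W.b₂ / 12) = 0) :
    (padicValInt 2 W.minimalDiscriminantInt = 4 →
      (∃ (W' : WeierstrassCurve ℚ) (_ : W'.IsElliptic) (_ : W'.IsGloballyMinimal), IsIsogenous W W' ∧
        W'.c₄ = 720 * q ^ 2 - 4 * W.c₄ ∧ W'.c₆ = 19008 * q ^ 3 - 144 * W.c₄ * q ∧ padicValInt 2 W'.minimalDiscriminantInt = 8) ∧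
      ¬ ∃ W' : WeierstrassCurve ℚ, W'.IsElliptic ∧ W'.IsGloballyMinimal ∧
        (2 : ℚ) ^ 4 * W'.c₄ = 720 * q ^ 2 - 4 * W.c₄ ∧ (2 : ℚ) ^ 6 * W'.c₆ = 19008 * q ^ 3 - 144 * W.c₄ * q) ∧
    (padicValInt 2 W.minimalDiscriminantInt = 8 →
      (∀ (W' : WeierstrassCurve ℚ) [W'.IsElliptic] [W'.IsGloballyMinimal],
        W'.c₄ = 720 * q ^ 2 - 4 * W.c₄ → W'.c₆ = 19008 * q ^ 3 - 144 * W.c₄ * q → padicValInt 2 W'.minimalDiscriminantInt = 16) ∧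
      (∀ (W' : WeierstrassCurve ℚ) [W'.IsElliptic] [W'.IsGloballyMinimal],
        (2 : ℚ) ^ 4 * W'.c₄ = 720 * q ^ 2 - 4 * W.c₄ → (2 : ℚ) ^ 6 * W'.c₆ = 19008 * q ^ 3 - 144 * W.c₄ * q →
          padicValInt 2 W'.minimalDiscriminantInt = 4) ∧
      ((∀ (W' : WeierstrassCurve ℚ) [W'.IsElliptic] [W'.IsGloballyMinimal], IsIsogenous W W' → ¬ 2 ^ 3 ∣ W'.conductorNorm ℤ) →
        ∃ (W' : WeierstrassCurve ℚ) (_ : W'.IsElliptic) (_ : W'.IsGloballyMinimal), IsIsogenous W W' ∧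
          (2 : ℚ) ^ 4 * W'.c₄ = 720 * q ^ 2 - 4 * W.c₄ ∧ (2 : ℚ) ^ 6 * W'.c₆ = 19008 * q ^ 3 - 144 * W.c₄ * q ∧
          padicValInt 2 W'.minimalDiscriminantInt = 4)) := by
  haveI : Fact (Nat.Prime 2) := ⟨Nat.prime_two⟩
  refine ⟨fun hΔ4 ↦ ⟨exists_isIsogenous_velu_two_of_IV W h4 h8 hΔ4 q hq,
      not_exists_isGloballyMinimal_two_velu_two_of_IV W h4 h8 hΔ4 q hq⟩,
    fun hΔ8 ↦ ⟨fun W' _ _ h4' h6' ↦ padicValInt_minimalDiscriminantInt_eq_sixteen_of_velu_two_of_IVstar W h4 h8 hΔ8 q hq W' h4' h6',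
      fun W' _ _ h4' h6' ↦ padicValInt_minimalDiscriminantInt_eq_four_of_two_velu_two_of_IVstar W h4 h8 hΔ8 q hq W' h4' h6',
      fun hnowild ↦ exists_isIsogenous_two_velu_two_of_IVstar_of_tame W h4 h8 hΔ8 q hq fun W' _ _ hiso ↦
        ⟨sq_dvd_conductorNorm_of_isIsogenous 2 h4 hiso, hnowild W' hiso⟩⟩⟩

/-- **The tame Néron-scalar table at `2`, granted `exists_isNewformOf` and a newform of `W`** (conductor invariance: no isogenous curve is wild at `2`).
[cite: SilvermanATAEC1994, IV.9.4 Table 4.1] [cite: AtkinLehner1970, Thm. 4] -/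
theorem tameTwo_neronScalar_table_of_isNewformOf (hnf : exists_isNewformOf) (W : WeierstrassCurve ℚ) [W.IsElliptic] [W.IsGloballyMinimal]
    {N : ℕ} [NeZero N] {f : CuspForm (Gamma0 N) 2} (hf : IsNewformOf W f) (h4 : 2 ^ 2 ∣ N) (h8 : ¬ 2 ^ 3 ∣ N)
    (q : ℚ) (hq : W.Ψ₂Sq.eval (q - W.b₂ / 12) = 0) :
    (padicValInt 2 W.minimalDiscriminantInt = 4 →
      (∃ (W' : WeierstrassCurve ℚ) (_ : W'.IsElliptic) (_ : W'.IsGloballyMinimal), IsIsogenous W W' ∧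
        W'.c₄ = 720 * q ^ 2 - 4 * W.c₄ ∧ W'.c₆ = 19008 * q ^ 3 - 144 * W.c₄ * q ∧ padicValInt 2 W'.minimalDiscriminantInt = 8) ∧
      ¬ ∃ W' : WeierstrassCurve ℚ, W'.IsElliptic ∧ W'.IsGloballyMinimal ∧
        (2 : ℚ) ^ 4 * W'.c₄ = 720 * q ^ 2 - 4 * W.c₄ ∧ (2 : ℚ) ^ 6 * W'.c₆ = 19008 * q ^ 3 - 144 * W.c₄ * q) ∧
    (padicValInt 2 W.minimalDiscriminantInt = 8 →
      (∃ (W' : WeierstrassCurve ℚ) (_ : W'.IsElliptic) (_ : W'.IsGloballyMinimal), IsIsogenous W W' ∧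
          (2 : ℚ) ^ 4 * W'.c₄ = 720 * q ^ 2 - 4 * W.c₄ ∧ (2 : ℚ) ^ 6 * W'.c₆ = 19008 * q ^ 3 - 144 * W.c₄ * q ∧
          padicValInt 2 W'.minimalDiscriminantInt = 4) ∧
      ¬ ∃ (W' : WeierstrassCurve ℚ) (_ : W'.IsElliptic) (_ : W'.IsGloballyMinimal), IsIsogenous W W' ∧
        W'.c₄ = 720 * q ^ 2 - 4 * W.c₄ ∧ W'.c₆ = 19008 * q ^ 3 - 144 * W.c₄ * q) := by
  haveI : Fact (Nat.Prime 2) := ⟨Nat.prime_two⟩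
  have hN : N = W.conductorNorm ℤ := IsNewformOf.level_eq_conductorNorm_of_exists_isNewformOf hnf hf
  have h4W : 2 ^ 2 ∣ W.conductorNorm ℤ := hN ▸ h4
  have h8W : ¬ 2 ^ 3 ∣ W.conductorNorm ℤ := hN ▸ h8
  have htame : ∀ (W' : WeierstrassCurve ℚ) [W'.IsElliptic], IsIsogenous W W' →
      2 ^ 2 ∣ W'.conductorNorm ℤ ∧ ¬ 2 ^ 3 ∣ W'.conductorNorm ℤ := fun W' _ hiso ↦ by
    have hN' : N = W'.conductorNorm ℤ :=
      IsNewformOf.level_eq_conductorNorm_of_exists_isNewformOf hnf (hf.of_isIsogenous hiso.symm_of_charZero)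
    exact ⟨hN' ▸ h4, hN' ▸ h8⟩
  obtain ⟨hIV, hIVstar⟩ := tameTwo_neronScalar_table W h4W h8W q hq
  refine ⟨hIV, fun hΔ8 ↦ ⟨(hIVstar hΔ8).2.2 fun W' _ _ hiso ↦ (htame W' hiso).2, ?_⟩⟩
  rintro ⟨W', hE', hM', hiso, h4', h6'⟩
  have h16 := (hIVstar hΔ8).1 W' h4' h6'
  obtain ⟨h4', h8'⟩ := htame W' hiso
  rcases padicValInt_minimalDiscriminantInt_eq_four_or_eight_of_tame_two W' h4' h8' with h | h <;> omega

end Summit.BirchSwinnertonDyer.BirchSwinnertonDyer.Theorems.ManinLocalTwoThree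

end
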